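import Literature.Topology.FourManifolds.HCobordismSlideStepCrossingValue
import Literature.Topology.FourManifolds.HCobordismIntersectionNumberSlabProofs
import HarnessLib

/-!
# Milnor 1965, proof of Thm. 7.6 (PDF p. 52): the part of the slid disc above the isotopy is the
# old disc — a common open `k`-ball of all constructions, and the crossing charts there

Topic `Literature/Topology/FourManifolds`; bricks for the last hypothesis `HSgn` (the sign of one
docking is `+1`) of `Cobordism.Milnor1965_basisTheorem_slab_of_crossingSign`
(`HCobordismSlideStepCrossingValue.lean`; named fact
`Literature.Topology.FourManifolds.Cobordism.Milnor1965_basisTheorem_slab`, Milnor, *Lectures on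
the h-cobordism theorem* (1965), Thm. 7.6 on a slab).  Milnor fixes the sign
`D_R(p₂) · D_L'(p₁) = +1` by the choice of the frame `μ(b)` in Lemma 7.7 (PDF p. 51); the tree
performs the slide for the two dockings `ρ`, `ρ ∘ r` (`r` a reflection of the sheet directions)
and compares the classes of the two slid discs through the pieces they share.  This file
provides those pieces:

* `SlideSetting.exists_homeomorph_topDisc` — for a level `a_L ∈ [c₀, c₁)` the set
  `D^∘(a_L) = {y ∈ W^s_ξ(σ i) | a_L < g₁ y}` (the old left-hand disc of `σ i` strictly above the
  level `a_L`) is homeomorphic to `ℝᵏ` (the parametrised cell of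
  `Cobordism.IsMorseFunction.exists_leftHandDisc_param`, Cor. 3.15, restricted to the open ball);
  it contains `σ i` (`σi_mem_topDisc`) and lies in the slab (`mem_slab_of_mem_topDisc`); the
  chart domains `{a ∈ (a₋, a₊)}` of the coordinates `L_k(a, x)` are preconnected
  (`isPreconnected_of_iff_chartDomain`, `isPreconnected_levelStrip`; `χL_target`);
* `SlideSetting.mem_leftHandDisc'_iff_of_lt` — **above the isotopy the new disc is the old one**
  (PDF p. 52, *"`ξ' = ξ` also to the right of `V₀ × [0, 1]`"* together with the track formula of
  Lemma 4.7 where `ν = 0`): for an outcome of `SlideSetting.exists_slidePair` with step heights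
  `t₁' < t₂'`, a point `y` with `t₂' ≤ a_L < g₁ y` lies on `D_L'(σ i)` iff it lies on
  `W^s_ξ(σ i)` (`SlideSetting.mem_stableSet_iff_of_nu_eq_zero`, `…_of_c₁_le`);
* `SlideSetting.crossingChart_eq_levelProj_of_le` — above `t₂'` the crossing chart of
  `SlideSetting.exists_crossingChart` is the flow-up of the sheet: `E(L_k(a, x))` is the point
  at the level `a` on the `ξ`-trajectory through `ι ψ_L^ρ(0, x, 0)`, for every slab flow of
  `(g₁, ξ)` on the band; hence (`SlideSetting.psiL_sheet_trans`) the charts of two outcomes for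
  the dockings `ρ` and `r ≫ ρ` satisfy `E'(L_k(a, x)) = E(L_k(a, r x))` there
  (`SlideSetting.crossingChart_trans_eq_of_le`).

Everything here is proved; no definitions, no named facts.

## References

* J. Milnor, *Lectures on the h-cobordism theorem*, notes by L. Siebenmann and J. Sondow,
  Princeton Mathematical Notes (1965): Cor. 3.15 (PDF p. 19), Lemma 4.7 (PDF p. 25), Lemma 7.7
  and the proof of Thm. 7.6 (PDF pp. 50–52).  Held:
  `lit read book:milnornd-lectures-h-cobordism-theorem`. [MilnorHCobordism1965]
-/

open scoped Manifold ContDiff Topology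
open Set Function Filter Metric

noncomputable section

namespace Literature.Topology.FourManifolds

universe u

section Heavy

variable {n : ℕ} {M N : Type u} [TopologicalSpace M] [T2Space M] [SecondCountableTopology M]
  [ChartedSpace (EuclideanSpace ℝ (Fin n)) M] [IsManifold (𝓡 n) ∞ M] [CompactSpace M]
  [TopologicalSpace N] [T2Space N] [SecondCountableTopology N]
  [ChartedSpace (EuclideanSpace ℝ (Fin n)) N] [IsManifold (𝓡 n) ∞ N] [CompactSpace N]

namespace SlideSetting

variable {c : Cobordism n M N} {g : c.W → ℝ}
  {ξ : Cₛ^∞⟮𝓡∂ (n + 1); EuclideanSpace ℝ (Fin (n + 1)), (TangentSpace (𝓡∂ (n + 1)) : c.W → Type)⟯}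
  {t₀ t₁ b : ℝ} {k a : ℕ} {σ : Fin a → c.W} {i j : Fin a}
  (S : SlideSetting c g ξ t₀ t₁ b k σ i j)

omit [T2Space M] [SecondCountableTopology M] [IsManifold (𝓡 n) ∞ M] [CompactSpace M] [T2Space N]
  [SecondCountableTopology N] [IsManifold (𝓡 n) ∞ N] [CompactSpace N] in
/-- The chart `χ_L` of the sphere `S^{k-1}` at `v_L` is a stereographic projection: its target
is all of `ℝ^{k-1}`. [folklore] -/
theorem χL_target : S.χL.target = univ := by
  haveI : Fact (Module.finrank ℝ (EuclideanSpace ℝ (Fin (k - 1 + 1))) = k - 1 + 1) :=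
    ⟨finrank_euclideanSpace_fin⟩
  show (chartAt (EuclideanSpace ℝ (Fin (k - 1))) S.vL).target = univ
  exact stereographic'_target _

omit [T2Space M] [SecondCountableTopology M] [IsManifold (𝓡 n) ∞ M] [CompactSpace M] [T2Space N]
  [SecondCountableTopology N] [IsManifold (𝓡 n) ∞ N] [CompactSpace N] in
/-- **The domain of the crossing chart is preconnected**: in the coordinates `p = L_k(a, x)` it
is the slab `{a ∈ (a₋, a₊)}` (the sphere chart has target `ℝ^{k-1}`), the image of
`(a₋, a₊) × ℝ^{k-1}` under `L_k`. [folklore] -/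
theorem isPreconnected_of_iff_chartDomain
    (ρ : (EuclideanSpace ℝ (Fin (k - 1))) ≃ₗᵢ[ℝ] EuclideanSpace ℝ (Fin (k - 1))) {alo ahi : ℝ}
    {Vk : Set (EuclideanSpace ℝ (Fin k))}
    (hVk : ∀ p, p ∈ Vk ↔ ((S.Lk.symm p).1 ∈ Ioo alo ahi ∧ S.xL + ρ (S.Lk.symm p).2 ∈ S.χL.target)) :
    IsPreconnected Vk := by
  have hVk' : Vk = S.Lk '' (Ioo alo ahi ×ˢ (univ : Set (EuclideanSpace ℝ (Fin (k - 1))))) := by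
    ext p
    constructor
    · intro hp
      exact ⟨S.Lk.symm p, ⟨((hVk p).1 hp).1, trivial⟩, S.Lk.apply_symm_apply p⟩
    · rintro ⟨q, hq, rfl⟩
      refine (hVk _).2 ⟨?_, ?_⟩
      · rw [ContinuousLinearEquiv.symm_apply_apply]; exact hq.1
      · rw [S.χL_target]; trivial
  rw [hVk']
  exact (isPreconnected_Ioo.prod isPreconnected_univ).image _ S.Lk.continuous.continuousOn

omit [T2Space M] [SecondCountableTopology M] [IsManifold (𝓡 n) ∞ M] [CompactSpace M] [T2Space N]
  [SecondCountableTopology N] [IsManifold (𝓡 n) ∞ N] [CompactSpace N] in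
/-- The open slab `{a₁ < a < a₂}` of the coordinates `p = L_k(a, x)` is open, preconnected and the
image of `(a₁, a₂) × ℝ^{k-1}` under `L_k`. [folklore] -/
theorem levelStrip_eq_image (a₁ a₂ : ℝ) :
    {p : EuclideanSpace ℝ (Fin k) | a₁ < (S.Lk.symm p).1 ∧ (S.Lk.symm p).1 < a₂} =
      S.Lk '' (Ioo a₁ a₂ ×ˢ (univ : Set (EuclideanSpace ℝ (Fin (k - 1))))) := by
  ext p
  constructor
  · intro hp
    exact ⟨S.Lk.symm p, ⟨hp, trivial⟩, S.Lk.apply_symm_apply p⟩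
  · rintro ⟨q, hq, rfl⟩
    show a₁ < (S.Lk.symm (S.Lk q)).1 ∧ (S.Lk.symm (S.Lk q)).1 < a₂
    rw [ContinuousLinearEquiv.symm_apply_apply]; exact hq.1

omit [T2Space M] [SecondCountableTopology M] [IsManifold (𝓡 n) ∞ M] [CompactSpace M] [T2Space N]
  [SecondCountableTopology N] [IsManifold (𝓡 n) ∞ N] [CompactSpace N] in
/-- The open slab `{a₁ < a < a₂}` of the coordinates `p = L_k(a, x)` is open. [folklore] -/
theorem isOpen_levelStrip (a₁ a₂ : ℝ) :
    IsOpen {p : EuclideanSpace ℝ (Fin k) | a₁ < (S.Lk.symm p).1 ∧ (S.Lk.symm p).1 < a₂} := by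
  have hc : Continuous fun p : EuclideanSpace ℝ (Fin k) => (S.Lk.symm p).1 :=
    continuous_fst.comp S.Lk.symm.continuous
  exact (isOpen_lt continuous_const hc).inter (isOpen_lt hc continuous_const)

omit [T2Space M] [SecondCountableTopology M] [IsManifold (𝓡 n) ∞ M] [CompactSpace M] [T2Space N]
  [SecondCountableTopology N] [IsManifold (𝓡 n) ∞ N] [CompactSpace N] in
/-- The open slab `{a₁ < a < a₂}` of the coordinates `p = L_k(a, x)` is preconnected. [folklore] -/
theorem isPreconnected_levelStrip (a₁ a₂ : ℝ) :
    IsPreconnected {p : EuclideanSpace ℝ (Fin k) | a₁ < (S.Lk.symm p).1 ∧ (S.Lk.symm p).1 < a₂} := by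
  rw [S.levelStrip_eq_image]
  exact (isPreconnected_Ioo.prod isPreconnected_univ).image _ S.Lk.continuous.continuousOn

omit [T2Space M] [SecondCountableTopology M] [IsManifold (𝓡 n) ∞ M] [CompactSpace M] [T2Space N]
  [SecondCountableTopology N] [IsManifold (𝓡 n) ∞ N] [CompactSpace N] in
/-- **The critical point `σ i` lies in its old left-hand disc above every level `a_L < c₁`**
(`g₁ (σ i) = b_P > c₁`). [folklore] -/
theorem σi_mem_topDisc {aL : ℝ} (h₁ : aL < S.c₁) :
    σ i ∈ stableSet (𝓡∂ (n + 1)) (⇑ξ) (σ i) ∧ aL < S.g₁ (σ i) :=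
  ⟨self_mem_stableSet (S.hξ₁.apply_eq_zero_of_isMCriticalPt (S.σ_mem_criticalSet₁ i)),
    by rw [S.g₁_σi]; exact h₁.trans S.hc₁bP⟩

omit [T2Space M] [SecondCountableTopology M] [IsManifold (𝓡 n) ∞ M] [CompactSpace M] [T2Space N]
  [SecondCountableTopology N] [IsManifold (𝓡 n) ∞ N] [CompactSpace N] in
/-- **The old left-hand disc above a level `a_L ≥ c₀` lies in the slab `X = g⁻¹[t₀, t₁]`**
(`g₁ ≤ g₁ (σ i) = b_P < t₁` on the stable set, `a_L > u > t₀`, and `g₁⁻¹[t₀, t₁] = g⁻¹[t₀, t₁]`).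
[folklore] -/
theorem mem_slab_of_mem_topDisc {X : Set c.W} (hX : ∀ z, z ∈ X ↔ g z ∈ Icc t₀ t₁) {aL : ℝ}
    (h₀ : S.c₀ ≤ aL) {y : c.W} (hy : y ∈ stableSet (𝓡∂ (n + 1)) (⇑ξ) (σ i) ∧ aL < S.g₁ y) : y ∈ X := by
  have h1 : S.g₁ y ≤ S.bP := by
    rw [← S.g₁_σi]; exact S.hξ₁.apply_le_of_mem_stableSet S.mdifferentiable_g₁ hy.1
  have h2 : y ∈ S.g₁ ⁻¹' Icc t₀ t₁ :=
    ⟨by linarith [hy.2, S.ht₀u, S.huc₀], by linarith [S.hbPv, S.hvt₁]⟩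
  rw [S.preimage_g₁_Icc] at h2
  exact (hX y).2 h2

omit [T2Space M] [SecondCountableTopology M] [IsManifold (𝓡 n) ∞ M] [CompactSpace M] [T2Space N]
  [SecondCountableTopology N] [IsManifold (𝓡 n) ∞ N] [CompactSpace N] in
/-- **Above `c₀` the new function exceeds `t₀`**: for an alteration `g'` of `g` on `g⁻¹(u, v)`
mapping `g₁⁻¹(u, v)` into `(u, v)`, every `y` with `c₀ < g₁ y` has `t₀ < g' y` (so such points of
the new left-hand disc are off the new left-hand sphere `{g' = t₀}`). [folklore] -/
theorem lt_newFunction_of_c₀_lt {g' : c.W → ℝ} (hIoo : ∀ z, S.g₁ z ∈ Ioo S.u S.v → g' z ∈ Ioo S.u S.v)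
    (halt : ∀ z, g z ∉ Ioo S.u S.v → g' z = g z) {y : c.W} (hy : S.c₀ < S.g₁ y) : t₀ < g' y := by
  by_cases h : S.g₁ y ∈ Ioo S.u S.v
  · exact S.ht₀u.trans (hIoo y h).1
  · have h1 : g y ∉ Ioo S.u S.v := fun h' => h (S.g₁_mem y h')
    rw [halt y h1, ← S.g₁_eq y h1]
    rcases not_and_or.1 (fun h2 => h ⟨h2.1, h2.2⟩) with h2 | h2
    · exact absurd (S.huc₀.trans hy) h2
    · linarith [S.ht₀u, S.huc₀, not_lt.1 h2]

/-- **The old left-hand disc of `σ i` strictly above a level `a_L ∈ [c₀, c₁)` is an open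
`k`-cell**: `{y ∈ W^s_ξ(σ i) | a_L < g₁ y}` is homeomorphic to `ℝᵏ` (it is the interior of the
parametrised cell `D_L(σ i)` of `(g₁, ξ)` down to the level `a_L`,
`Cobordism.IsMorseFunction.exists_leftHandDisc_param` — no critical value of `g₁` lies in
`[a_L, g₁ σ i)` — i.e. an open unit ball, `Homeomorph.unitBall`).
[cite: MilnorHCobordism1965, Cor. 3.15 (PDF p. 19), Def. 3.9 (PDF p. 16)] -/
theorem exists_homeomorph_topDisc {aL : ℝ} (h₀ : S.c₀ ≤ aL) (h₁ : aL < S.c₁) :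
    Nonempty ({y : c.W // y ∈ stableSet (𝓡∂ (n + 1)) (⇑ξ) (σ i) ∧ aL < S.g₁ y} ≃ₜ
      EuclideanSpace ℝ (Fin k)) := by
  have haL0 : 0 ≤ aL := S.hc₀_pos.le.trans h₀
  have hq : σ i ∈ criticalSetOfIndex (𝓡∂ (n + 1)) S.g₁ k := ⟨S.σ_mem_criticalSet₁ i, S.morseIndex₁_σ i⟩
  have haq : aL < S.g₁ (σ i) := by rw [S.g₁_σi]; exact h₁.trans S.hc₁bP
  have hnoval : ∀ z ∈ criticalSet (𝓡∂ (n + 1)) S.g₁, S.g₁ z ∉ Ico aL (S.g₁ (σ i)) := by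
    intro z hz hzI
    rw [S.g₁_σi] at hzI
    rcases S.criticalSet₁_cases hz with rfl | ⟨l, hl, rfl⟩ | ⟨h1, h2⟩
    · rw [S.g₁_σi] at hzI; exact lt_irrefl _ hzI.2
    · rw [S.g₁_σ l hl] at hzI; linarith [hzI.1, S.hbc₀]
    · apply h2
      rw [← h1]
      exact ⟨by linarith [hzI.1, S.ht₀u, S.huc₀], by linarith [hzI.2, S.hbPv, S.hvt₁]⟩
  obtain ⟨ψ, hψi, hψr, hψl, -⟩ := S.hg₁.exists_leftHandDisc_param ξ S.hξ₁ haL0 hq haq hnoval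
  have hbc : ball (0 : EuclideanSpace ℝ (Fin k)) 1 ⊆ closedBall 0 1 := ball_subset_closedBall
  -- the points of the open ball go to the disc strictly above the level
  have hmem : ∀ v : ↥(ball (0 : EuclideanSpace ℝ (Fin k)) 1),
      ψ (inclusion hbc v) ∈ stableSet (𝓡∂ (n + 1)) (⇑ξ) (σ i) ∧ aL < S.g₁ (ψ (inclusion hbc v)) := by
    intro v
    have hD : ψ (inclusion hbc v) ∈ leftHandDisc (𝓡∂ (n + 1)) S.g₁ (⇑ξ) (σ i) aL := by
      rw [← hψr]; exact mem_range_self _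
    refine ⟨hD.1, lt_of_le_of_ne hD.2 fun h => ?_⟩
    have h1 := (hψl (inclusion hbc v)).1 h.symm
    rw [coe_inclusion] at h1
    exact (mem_ball_zero_iff.1 v.2).ne h1
  let f : ↥(ball (0 : EuclideanSpace ℝ (Fin k)) 1) →
      {y : c.W // y ∈ stableSet (𝓡∂ (n + 1)) (⇑ξ) (σ i) ∧ aL < S.g₁ y} :=
    fun v => ⟨ψ (inclusion hbc v), hmem v⟩
  -- `f` is an embedding: `ψ` is a closed embedding of the compact closed ball
  haveI : CompactSpace ↥(closedBall (0 : EuclideanSpace ℝ (Fin k)) 1) :=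
    isCompact_iff_compactSpace.1 (isCompact_closedBall 0 1)
  have hψemb : Topology.IsEmbedding ψ := (ψ.continuous.isClosedEmbedding hψi).isEmbedding
  have hfemb : Topology.IsEmbedding f :=
    (hψemb.comp (Topology.IsEmbedding.inclusion hbc)).codRestrict
      {y | y ∈ stableSet (𝓡∂ (n + 1)) (⇑ξ) (σ i) ∧ aL < S.g₁ y} hmem
  -- `f` is onto
  have hfsurj : Surjective f := by
    rintro ⟨y, hys, hya⟩
    have hyD : y ∈ range ψ := by rw [hψr]; exact ⟨hys, hya.le⟩
    obtain ⟨x, rfl⟩ := hyD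
    have hx1 : ‖(x : EuclideanSpace ℝ (Fin k))‖ ≠ 1 := fun h => hya.ne' ((hψl x).2 h)
    have hx : (x : EuclideanSpace ℝ (Fin k)) ∈ ball (0 : EuclideanSpace ℝ (Fin k)) 1 :=
      mem_ball_zero_iff.2 (lt_of_le_of_ne (mem_closedBall_zero_iff.1 x.2) hx1)
    exact ⟨⟨x.1, hx⟩, rfl⟩
  exact ⟨((isHomeomorph_iff_isEmbedding_surjective.2 ⟨hfemb, hfsurj⟩).homeomorph f).symm.trans
    Homeomorph.unitBall.symm⟩

omit [T2Space M] [SecondCountableTopology M] [IsManifold (𝓡 n) ∞ M] [CompactSpace M] [T2Space N]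
  [SecondCountableTopology N] [IsManifold (𝓡 n) ∞ N] [CompactSpace N] in
/-- **Above the isotopy the new left-hand disc is the old one** (Milnor 1965, PDF p. 52, with
the track formula of Lemma 4.7): for an outcome of `SlideSetting.exists_slidePair` (swept field
`ξ₃`, isotopy `F` with the flow relations, explicit `ν` with `ν = 0` from `t₂'` on, and the new
function `g'`, an alteration of `g` on `g⁻¹(u, v)` mapping `g₁⁻¹(u, v)` into `(u, v)`), a point
`y` above a level `a_L ≥ t₂'` lies on `D_L'(σ i)` (the left-hand disc of `σ i` for `(g', ξ₃)`
down to `t₀`) iff it lies on the old stable set `W^s_ξ(σ i)`.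
[cite: MilnorHCobordism1965, Lemma 4.7 (PDF p. 25), proof of Thm. 7.6 (PDF p. 52)] -/
theorem mem_leftHandDisc'_iff_of_lt
    {ξ₃ : Cₛ^∞⟮𝓡∂ (n + 1); EuclideanSpace ℝ (Fin (n + 1)), (TangentSpace (𝓡∂ (n + 1)) : c.W → Type)⟯}
    (hξ₃ : IsGradientLike (𝓡∂ (n + 1)) S.g₁ ξ₃) (hξ₃eq : ∀ z, S.g₁ z ∉ Ioo S.c₀ S.c₁ → ξ₃ z = ξ z)
    {F : AmbientIsotopy (𝓡 n) S.V} {ν : ℝ → ℝ}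
    (htrack : ∀ q : S.V, ∀ τ ∈ Icc 0 (S.c₁ - S.c₀), ∃ y : c.W, S.g₁ y = S.c₀ + τ ∧
      FlowsTo (𝓡∂ (n + 1)) ξ (S.ι (F.toFun (ν (S.c₀ + τ)) q)) y ∧
      FlowsTo (𝓡∂ (n + 1)) ξ₃ (S.ι (F.toFun 1 q)) y)
    (hleft : leftHandSphere (𝓡∂ (n + 1)) S.g₁ ξ₃ (σ i) S.c₀ = S.ι '' (F.toFun 1 '' S.leftSphere))
    {t₁' t₂' : ℝ} (h12 : t₁' < t₂')
    (hνt : ∀ t, ν t = Real.smoothTransition ((t₂' - t) / (t₂' - t₁')))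
    {g' : c.W → ℝ} (hIoo : ∀ z, S.g₁ z ∈ Ioo S.u S.v → g' z ∈ Ioo S.u S.v)
    (halt : ∀ z, g z ∉ Ioo S.u S.v → g' z = g z)
    {aL : ℝ} (haL : t₂' ≤ aL) (haL₀ : S.c₀ < aL) {y : c.W} (hy : aL < S.g₁ y) :
    y ∈ leftHandDisc (𝓡∂ (n + 1)) g' (⇑ξ₃) (σ i) t₀ ↔ y ∈ stableSet (𝓡∂ (n + 1)) (⇑ξ) (σ i) := by
  -- `t₀ ≤ g' y` is automatic
  have hg't₀ : t₀ ≤ g' y := (S.lt_newFunction_of_c₀_lt hIoo halt (haL₀.trans hy)).le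
  have hiff : y ∈ stableSet (𝓡∂ (n + 1)) (⇑ξ₃) (σ i) ↔ y ∈ stableSet (𝓡∂ (n + 1)) (⇑ξ) (σ i) := by
    by_cases hc : S.c₁ ≤ S.g₁ y
    · exact S.mem_stableSet_iff_of_c₁_le hξ₃ hξ₃eq hc (σ i)
    · rw [not_le] at hc
      refine S.mem_stableSet_iff_of_nu_eq_zero hξ₃ htrack hleft (haL₀.trans hy) hc ?_
      rw [hνt]
      exact Real.smoothTransition.zero_of_nonpos
        (div_nonpos_of_nonpos_of_nonneg (by linarith) (by linarith))
  exact ⟨fun h => hiff.1 h.1, fun h => ⟨hiff.2 h, hg't₀⟩⟩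

omit [T2Space M] [SecondCountableTopology M] [IsManifold (𝓡 n) ∞ M] [CompactSpace M] [T2Space N]
  [SecondCountableTopology N] [IsManifold (𝓡 n) ∞ N] [CompactSpace N] in
/-- **Above `t₂'` the crossing chart is the flow-up of the sheet**: if the chart `E` of
`SlideSetting.exists_crossingChart` satisfies its flow clause (`g₁(E p) = a` and a
`ξ`-trajectory runs from `ι F_{ν(a)}(ψ_L^ρ(0, x, 0))` to `E p`, `p = L_k(a, x)`), then for
`a ≥ t₂'` (where `ν(a) = 0` and `F₀ = id`) `E p` is the translate of the sheet point
`ι ψ_L^ρ(0, x, 0)` to the level `a` along any slab flow of `(g₁, ξ)` on the band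
(`Cobordism.PreSlabFlow.eq_levelProj_of_flowsTo'`). [cite: MilnorHCobordism1965, Lemma 4.7 (PDF p. 25), proof of Thm. 7.6 (PDF p. 52)] -/
theorem crossingChart_eq_levelProj_of_le
    (ρ : (EuclideanSpace ℝ (Fin (k - 1))) ≃ₗᵢ[ℝ] EuclideanSpace ℝ (Fin (k - 1)))
    {F : AmbientIsotopy (𝓡 n) S.V} {ν : ℝ → ℝ} {t₁' t₂' : ℝ} (h12 : t₁' < t₂')
    (hνt : ∀ t, ν t = Real.smoothTransition ((t₂' - t) / (t₂' - t₁')))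
    {Vk : Set (EuclideanSpace ℝ (Fin k))} {E : EuclideanSpace ℝ (Fin k) → c.W}
    (hflowE : ∀ p ∈ Vk, S.g₁ (E p) = (S.Lk.symm p).1 ∧ (S.Lk.symm p).1 ∈ Ioo S.c₀ S.c₁ ∧
      FlowsTo (𝓡∂ (n + 1)) ξ (S.ι (F.toFun (ν (S.Lk.symm p).1)
        (S.psiL ρ (((0 : ℝ), (S.Lk.symm p).2, (0 : EuclideanSpace ℝ (Fin (n - k)))) : Model n k)))) (E p))
    {θ : ℝ × c.W → c.W} (hθ : c.SlabFlow S.g₁ (⇑ξ) S.c₀ S.c₁ θ)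
    {p : EuclideanSpace ℝ (Fin k)} (hp : p ∈ Vk) (ha : t₂' ≤ (S.Lk.symm p).1) :
    E p = Flow.levelProj θ S.g₁ (S.Lk.symm p).1
      (S.ι (S.psiL ρ (((0 : ℝ), (S.Lk.symm p).2, (0 : EuclideanSpace ℝ (Fin (n - k)))) : Model n k))) := by
  obtain ⟨hlev, hI, hflow⟩ := hflowE p hp
  have hν0 : ν (S.Lk.symm p).1 = 0 := by
    rw [hνt]
    exact Real.smoothTransition.zero_of_nonpos
      (div_nonpos_of_nonpos_of_nonneg (by linarith) (by linarith))
  rw [hν0, F.map_zero] at hflow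
  exact hθ.toPreSlabFlow.eq_levelProj_of_flowsTo' S.band_regular (Ioo_subset_Icc_self hI) hlev
    (by rw [S.apply_ι]; exact left_mem_Icc.2 S.hc₀c₁.le) hflow

omit [T2Space M] [SecondCountableTopology M] [IsManifold (𝓡 n) ∞ M] [CompactSpace M] [T2Space N]
  [SecondCountableTopology N] [IsManifold (𝓡 n) ∞ N] [CompactSpace N] in
/-- **The crossing charts of the two dockings agree above the isotopies up to the reflection**
(Milnor 1965, Lemma 7.7 and PDF p. 52; the sheet map is equivariant, `SlideSetting.psiL_sheet_trans`):
for two outcomes of `SlideSetting.exists_slidePair`, for the dockings `ρ` and `r ≫ ρ`, with charts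
`E`, `E'` satisfying their flow clauses, and a height `a` above both `t₂'`:
`E'(L_k(a, x)) = E(L_k(a, r x))` whenever both parameters lie in the chart domains.
[cite: MilnorHCobordism1965, Lemma 7.7 (PDF p. 51), proof of Thm. 7.6 (PDF p. 52)] -/
theorem crossingChart_trans_eq_of_le
    (ρ r : (EuclideanSpace ℝ (Fin (k - 1))) ≃ₗᵢ[ℝ] EuclideanSpace ℝ (Fin (k - 1)))
    {F : AmbientIsotopy (𝓡 n) S.V} {ν : ℝ → ℝ} {t₁' t₂' : ℝ} (h12 : t₁' < t₂')
    (hνt : ∀ t, ν t = Real.smoothTransition ((t₂' - t) / (t₂' - t₁')))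
    {Vk : Set (EuclideanSpace ℝ (Fin k))} {E : EuclideanSpace ℝ (Fin k) → c.W}
    (hflowE : ∀ p ∈ Vk, S.g₁ (E p) = (S.Lk.symm p).1 ∧ (S.Lk.symm p).1 ∈ Ioo S.c₀ S.c₁ ∧
      FlowsTo (𝓡∂ (n + 1)) ξ (S.ι (F.toFun (ν (S.Lk.symm p).1)
        (S.psiL ρ (((0 : ℝ), (S.Lk.symm p).2, (0 : EuclideanSpace ℝ (Fin (n - k)))) : Model n k)))) (E p))
    {F' : AmbientIsotopy (𝓡 n) S.V} {ν' : ℝ → ℝ} {s₁' s₂' : ℝ} (h12' : s₁' < s₂')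
    (hνt' : ∀ t, ν' t = Real.smoothTransition ((s₂' - t) / (s₂' - s₁')))
    {Vk' : Set (EuclideanSpace ℝ (Fin k))} {E' : EuclideanSpace ℝ (Fin k) → c.W}
    (hflowE' : ∀ p ∈ Vk', S.g₁ (E' p) = (S.Lk.symm p).1 ∧ (S.Lk.symm p).1 ∈ Ioo S.c₀ S.c₁ ∧
      FlowsTo (𝓡∂ (n + 1)) ξ (S.ι (F'.toFun (ν' (S.Lk.symm p).1)
        (S.psiL (r.trans ρ) (((0 : ℝ), (S.Lk.symm p).2, (0 : EuclideanSpace ℝ (Fin (n - k)))) : Model n k))))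
        (E' p))
    {a₁ : ℝ} (ha : t₂' ≤ a₁) (ha' : s₂' ≤ a₁) {x : EuclideanSpace ℝ (Fin (k - 1))}
    (hx' : S.Lk (a₁, x) ∈ Vk') (hx : S.Lk (a₁, r x) ∈ Vk) :
    E' (S.Lk (a₁, x)) = E (S.Lk (a₁, r x)) := by
  obtain ⟨θ, hθ⟩ := S.hg₁.exists_slabFlow ξ.contMDiff S.hξ₁ S.hc₀_pos S.hc₀c₁ S.hc₁_lt_one
  have h1 := S.crossingChart_eq_levelProj_of_le (r.trans ρ) h12' hνt' hflowE' hθ hx'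
    (by rw [ContinuousLinearEquiv.symm_apply_apply]; exact ha')
  have h2 := S.crossingChart_eq_levelProj_of_le ρ h12 hνt hflowE hθ hx
    (by rw [ContinuousLinearEquiv.symm_apply_apply]; exact ha)
  rw [h1, h2]
  simp only [ContinuousLinearEquiv.symm_apply_apply]
  rw [S.psiL_sheet_trans]

end SlideSetting

end Heavy

end Literature.Topology.FourManifolds

end
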